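import Summits.HodgeConjecture.CorCM.Census.CentralSquaresTransversal
import Summits.HodgeConjecture.CorCM.Census.CentralSquaresExchange

/-!
# The square-central class, VI: the transversal relations `R(T)` and `R(T) + Y'_a + Y'_{σa}` lie in the lattice of a strict lowering cover

COR-CM (cell `pub-hodgecm2`), count-neutral kernel combinatorics by the binder seat b09 (gen 45; lane SQUARE-CENTRAL CLASS, part VI), on parts IV
(`Census/CentralSquaresTransversal.lean`: star normal forms toward `T₀`) and V (`Census/CentralSquaresExchange.lean`: frame exchange), BY NAME.  Theorems only: no
definition, no `decide`, no certificate, no named fact, no `sorry`.  HONEST FRAMING: `HC_CM` is NOT proved, here or anywhere in the tree; nothing here is a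
period or a headline.

THE FRAME `(T₀; T₁, Q)`: base block `{T₀, T̄₀, T₁, T̄₁}`, `|T₀| = 4m`, `𝓗 = T₀ ∖ T₁` of size `2m`, a swap `Q` (`T₀·Q⁻¹ = T₁`, `Q² = 1`) whose place permutation
preserves `𝓗`, and a base-change stable lattice `L` holding a strict lowering cover (part I).  Notation: `e₀ = [T₀]`, `e₁ = [T₁]`, `f_s = [T₀^{(s)}]`,
`g_s = [T₁^{(s)}]`.

* §1 `thetaG_frame`: the star form toward `T₁` re-indexed over `T₀`-representatives,
  `θ_{T₁}(typeSum [X]) = Σ_{u ∈ D(X) ∖ 𝓗} (g_u − e₁) + Σ_{u ∈ 𝓗 ∖ D(X)} (g_u − e₁) + e₁`.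
* §2 **The exchanged frame `(T₁; T₀, Q)`** satisfies the hypotheses of part IV (`base_cases_exchange`, the strict cover via `cover_frame`).
* §3 **THE TRANSVERSAL RELATION** (`rel_transversal_mem`, `m ≥ 2`): for every transversal `T ⊆ 𝓗` of the swap with `|T| = m`,
  `R(T) = Σ_{s∈T} f_s − Σ_{u∈𝓗∖T} g_u − (m−1)(e₀ − e₁) ∈ L` — the difference of the two star normal forms of the `Q`-stable type with deviation set `T`.
* §4 **THE PAIR RELATION** (`rel_transversal_pair_mem`, `m ≥ 3`): for `a ∈ T₀ ∩ T₁` with swap image `a' ≠ a`,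
  `R(T) + Y'_a + Y'_{a'} ∈ L`, `Y'_x = (f_x − e₀) − (g_x − e₁)` — from the `Q`-stable type with deviation set `T ∪ {a, a'}`.
Part VII runs the companion frame `(T₀; T̄₁, c·Q)` (same place permutation), obtains `Rᶜ`, `Y_s + Y_{σs}`, `Y'_a − Y'_{σa}` and closes the four-type law.

## References
* [Pohlmann1968] H. Pohlmann, Algebraic cycles on abelian varieties of complex multiplication type, Ann. of Math. 88 (1968), Thm 1.
-/

namespace Summit.HodgeConjecture.CorCM.Census.CentralSquares

open Finset
open scoped symmDiff
open Summit.HodgeConjecture.CorCM.Prior.AllgGroup.RfwfAllgGroup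
open Summit.HodgeConjecture.CorCM.Census.BlockParity
open Summit.HodgeConjecture.CorCM.Census.Coinvariant
open Summit.HodgeConjecture.CorCM.Census.TwistGeneration
open Summit.HodgeConjecture.CorCM.Census.BaseBlock
open Summit.HodgeConjecture.CorCM.Census.CoverClosure

noncomputable section

variable {G : Type*} [Group G] [Fintype G] [DecidableEq G] (c : G)

/-! ## §1 The star form toward `T₁` over `T₀`-representatives -/

/-- **`θ_{T₁}` re-indexed**: `θ_{T₁}(typeSum [X]) = Σ_{u ∈ D ∖ 𝓗} (g_u − e₁) + Σ_{u ∈ 𝓗 ∖ D} (g_u − e₁) + e₁` (`D = T₀ ∖ X`, `𝓗 = T₀ ∖ T₁`). [folklore] -/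
theorem thetaG_frame (hc2 : c * c = 1) (T₀ T₁ X : CMF G c) :
    thetaG c hc2 T₁ (typeSum G c (Finsupp.single X 1)) =
      (∑ u ∈ (T₀.1 \ X.1) \ (T₀.1 \ T₁.1), (Finsupp.single (oflipCM c hc2 u T₁) (1 : ℤ) - Finsupp.single T₁ 1)) +
      (∑ u ∈ (T₀.1 \ T₁.1) \ (T₀.1 \ X.1), (Finsupp.single (oflipCM c hc2 u T₁) (1 : ℤ) - Finsupp.single T₁ 1)) +
      Finsupp.single T₁ 1 := by
  rw [thetaG_typeSum_single c T₁ hc2 X, sdiff_eq_of_dev c hc2 T₀ T₁ X,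
    sum_union (disjoint_dev_pieces c T₀ _ _ (sdiff_subset.trans sdiff_subset) (sdiff_subset.trans sdiff_subset)),
    sum_image fun x _ y _ h => mul_left_cancel h]
  simp only [oflipCM_cmul]

/-! ## §2 The exchanged frame -/

/-- The base block seen from `T₁ = T₀·Q⁻¹`. [folklore] -/
theorem base_cases_exchange {T₀ T₁ : CMF G c}
    (hbase : ∀ Q : G, rt c Q T₀ = T₀ ∨ rt c Q T₀ = rt c c T₀ ∨ rt c Q T₀ = T₁ ∨ rt c Q T₀ = rt c c T₁) {Q : G} (hQ : rt c Q T₀ = T₁) :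
    ∀ Q' : G, rt c Q' T₁ = T₁ ∨ rt c Q' T₁ = rt c c T₁ ∨ rt c Q' T₁ = T₀ ∨ rt c Q' T₁ = rt c c T₀ := by
  intro Q'
  have e : rt c Q' T₁ = rt c (Q' * Q) T₀ := by rw [rt_mul, hQ]
  rw [e]
  rcases hbase (Q' * Q) with h | h | h | h
  · exact Or.inr (Or.inr (Or.inl h))
  · exact Or.inr (Or.inr (Or.inr h))
  · exact Or.inl h
  · exact Or.inr (Or.inl h)

section Frame

variable (hc2 : c * c = 1) (hcen : ∀ x : G, x * c = c * x) (T₀ T₁ : CMF G c)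
variable (hbase : ∀ Q : G, rt c Q T₀ = T₀ ∨ rt c Q T₀ = rt c c T₀ ∨ rt c Q T₀ = T₁ ∨ rt c Q T₀ = rt c c T₁)
variable (m : ℕ) (hn : T₀.1.card = 4 * m) (hH : (T₀.1 \ T₁.1).card = 2 * m)
variable (Q : G) (hQ : rt c Q T₀ = T₁) (hQQ : Q * Q = 1)
variable (hσH : ∀ t ∈ T₀.1, ∀ t' ∈ T₀.1, (t' = t * Q ∨ t' = c * (t * Q)) → (t ∈ T₀.1 \ T₁.1 ↔ t' ∈ T₀.1 \ T₁.1))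
variable (L : Submodule ℤ (CMF G c →₀ ℤ)) (hLrt : ∀ (Q' : G) (y : CMF G c →₀ ℤ), y ∈ L → Finsupp.mapDomain (rt c Q') y ∈ L)
variable (hcover : ∀ Ψ : CMF G c, 2 ≤ bpot c T₀ Ψ → ∃ Q₂ s s' : G, bpot c T₀ Ψ = ddist (rt c Q₂ T₀) Ψ ∧
    s ∈ (rt c Q₂ T₀).1 \ Ψ.1 ∧ s' ∈ (rt c Q₂ T₀).1 \ Ψ.1 ∧ s ≠ s' ∧
    gface c hc2 Ψ s s' ∈ L ∧
    ((∃ Q₁ t t' : G, bpot c T₀ Ψ = ddist (rt c Q₁ T₀) Ψ ∧ t ∈ (rt c Q₁ T₀).1 \ Ψ.1 ∧ t' ∈ (rt c Q₁ T₀).1 \ Ψ.1 ∧ t ≠ t' ∧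
        (∀ Q' : G, ddist (rt c Q' T₀) (oflipCM c hc2 t Ψ) = bpot c T₀ (oflipCM c hc2 t Ψ) → rt c Q' T₀ = rt c Q₁ T₀) ∧
        (∀ Q' : G, ddist (rt c Q' T₀) (oflipCM c hc2 t' Ψ) = bpot c T₀ (oflipCM c hc2 t' Ψ) → rt c Q' T₀ = rt c Q₁ T₀) ∧
        (∀ Q' : G, ddist (rt c Q' T₀) (oflipCM c hc2 t (oflipCM c hc2 t' Ψ)) = bpot c T₀ (oflipCM c hc2 t (oflipCM c hc2 t' Ψ)) →
          rt c Q' T₀ = rt c Q₁ T₀)) →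
      (∀ Q' : G, ddist (rt c Q' T₀) (oflipCM c hc2 s Ψ) = bpot c T₀ (oflipCM c hc2 s Ψ) → rt c Q' T₀ = rt c Q₂ T₀) ∧
      (∀ Q' : G, ddist (rt c Q' T₀) (oflipCM c hc2 s' Ψ) = bpot c T₀ (oflipCM c hc2 s' Ψ) → rt c Q' T₀ = rt c Q₂ T₀) ∧
      (∀ Q' : G, ddist (rt c Q' T₀) (oflipCM c hc2 s (oflipCM c hc2 s' Ψ)) = bpot c T₀ (oflipCM c hc2 s (oflipCM c hc2 s' Ψ)) →
        rt c Q' T₀ = rt c Q₂ T₀)))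

include hc2 hn in
/-- All base types have `4m` elements. [folklore] -/
theorem card_frame : T₁.1.card = 4 * m := by
  have h0 := card_sdiff_add_card_inter T₀.1 T₁.1
  have h1 := card_sdiff_add_card_inter T₁.1 T₀.1
  rw [card_sdiff_frame c hc2 T₀ T₁, inter_comm] at h1
  omega

include hcen hbase hn hH hQ hQQ hσH hLrt hcover in
/-- **STAR NORMAL FORM TOWARD `T₁` OF THE TRANSVERSAL TYPE** — part IV in the exchanged frame `(T₁; T₀, Q)`: for a transversal `T ⊆ 𝓗` of size `m ≥ 2`,
every type whose `T₁`-deviation set lies in `c·(𝓗 ∖ T)` has `[X] − θ_{T₁}(typeSum [X]) ∈ L`. [folklore] -/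
theorem single_sub_thetaG_mem_transversal_exchange (hm : 2 ≤ m) (T : Finset G) (hTH : T ⊆ T₀.1 \ T₁.1) (hTm : T.card = m)
    (hT : ∀ t ∈ T₀.1 \ T₁.1, ∀ t' ∈ T₀.1, (t' = t * Q ∨ t' = c * (t * Q)) → (t ∈ T ↔ t' ∉ T)) :
    ∀ X : CMF G c, T₁.1 \ X.1 ⊆ ((T₀.1 \ T₁.1) \ T).image (fun x => c * x) →
      Finsupp.single X 1 - thetaG c hc2 T₁ (typeSum G c (Finsupp.single X 1)) ∈ L := by
  have hQ₁ : rt c Q T₁ = T₀ := by rw [← hQ, ← rt_mul, hQQ, rt_one]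
  have hcov := cover_frame c hc2 T₀ L Q hcover
  simp only [hQ] at hcov
  have hH₁ : (T₁.1 \ T₀.1).card = 2 * m := by rw [card_sdiff_frame c hc2 T₀ T₁, hH]
  have hsub : ((T₀.1 \ T₁.1) \ T).image (fun x => c * x) ⊆ T₁.1 \ T₀.1 := by
    intro x hx
    obtain ⟨u, hu, rfl⟩ := mem_image.mp hx
    obtain ⟨hu0, hu1⟩ := mem_sdiff.mp (mem_sdiff.mp hu).1
    exact mem_sdiff.mpr ⟨by by_contra h; exact hu1 ((T₁.2 u).mpr h), (T₀.2 u).mp hu0⟩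
  have hcard : (((T₀.1 \ T₁.1) \ T).image (fun x => c * x)).card = m := by
    rw [card_image_of_injective _ (mul_right_injective c), card_sdiff_of_subset hTH, hH, hTm]; omega
  exact single_sub_thetaG_mem_transversal c hc2 hcen T₁ T₀ (base_cases_exchange c hbase hQ) m (card_frame c hc2 T₀ T₁ m hn) hH₁ Q hQ₁ hQQ L
    hLrt hcov hm (swap_preserves_frame c hc2 T₀ T₁ Q hσH) _ hsub hcard (transversal_frame c hc2 T₀ T₁ Q hσH T hT)

include hcen hbase hn hH hQ hQQ hσH hLrt hcover in
/-- **STAR NORMAL FORM TOWARD `T₁` AT LEVEL `m + 2`** — part IV in the exchanged frame: for a transversal `T ⊆ 𝓗` of size `m ≥ 3` and `a ∈ T₀ ∩ T₁` with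
swap image `a' ≠ a`, every type whose `T₁`-deviation set lies in `c·(𝓗 ∖ T) ∪ {a, a'}` and is all of it or misses part of `c·(𝓗 ∖ T)` has
`[X] − θ_{T₁}(typeSum [X]) ∈ L`. [folklore] -/
theorem single_sub_thetaG_mem_transversal_pair_exchange (hm : 3 ≤ m) (T : Finset G) (hTH : T ⊆ T₀.1 \ T₁.1) (hTm : T.card = m)
    (hT : ∀ t ∈ T₀.1 \ T₁.1, ∀ t' ∈ T₀.1, (t' = t * Q ∨ t' = c * (t * Q)) → (t ∈ T ↔ t' ∉ T))
    {a a' : G} (ha : a ∈ T₀.1) (ha1 : a ∈ T₁.1) (ha' : a' ∈ T₀.1) (haa' : a' = a * Q ∨ a' = c * (a * Q)) (hne : a ≠ a') :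
    ∀ X : CMF G c, (T₁.1 \ X.1 ⊆ ((T₀.1 \ T₁.1) \ T).image (fun x => c * x) ∪ {a, a'} ∧
        (T₁.1 \ X.1 = ((T₀.1 \ T₁.1) \ T).image (fun x => c * x) ∪ {a, a'} ∨
          ¬ ((T₀.1 \ T₁.1) \ T).image (fun x => c * x) ⊆ T₁.1 \ X.1)) →
      Finsupp.single X 1 - thetaG c hc2 T₁ (typeSum G c (Finsupp.single X 1)) ∈ L := by
  have hQ₁ : rt c Q T₁ = T₀ := by rw [← hQ, ← rt_mul, hQQ, rt_one]
  have hcov := cover_frame c hc2 T₀ L Q hcover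
  simp only [hQ] at hcov
  have hH₁ : (T₁.1 \ T₀.1).card = 2 * m := by rw [card_sdiff_frame c hc2 T₀ T₁, hH]
  have hsub : ((T₀.1 \ T₁.1) \ T).image (fun x => c * x) ⊆ T₁.1 \ T₀.1 := by
    intro x hx
    obtain ⟨u, hu, rfl⟩ := mem_image.mp hx
    obtain ⟨hu0, hu1⟩ := mem_sdiff.mp (mem_sdiff.mp hu).1
    exact mem_sdiff.mpr ⟨by by_contra h; exact hu1 ((T₁.2 u).mpr h), (T₀.2 u).mp hu0⟩
  have hcard : (((T₀.1 \ T₁.1) \ T).image (fun x => c * x)).card = m := by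
    rw [card_image_of_injective _ (mul_right_injective c), card_sdiff_of_subset hTH, hH, hTm]; omega
  have ha'1 : a' ∈ T₁.1 := by
    have h := (hσH a ha a' ha' haa')
    by_contra h'
    exact (mem_sdiff.mp (h.mpr (mem_sdiff.mpr ⟨ha', h'⟩))).2 ha1
  have haH₁ : a ∉ T₁.1 \ T₀.1 := fun h => (mem_sdiff.mp h).2 ha
  exact single_sub_thetaG_mem_transversal_pair c hc2 hcen T₁ T₀ (base_cases_exchange c hbase hQ) m (card_frame c hc2 T₀ T₁ m hn) hH₁ Q hQ₁ hQQ
    L hLrt hcov hm (swap_preserves_frame c hc2 T₀ T₁ Q hσH) _ hsub hcard (transversal_frame c hc2 T₀ T₁ Q hσH T hT) ha1 haH₁ ha'1 haa' hne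

/-! ## §3 The transversal relation -/

include hcen hbase hn hH hQ hQQ hσH hLrt hcover in
/-- **THE TRANSVERSAL RELATION `R(T) ∈ L`** (`m ≥ 2`): for every transversal `T ⊆ 𝓗` of the swap with `|T| = m`,
`Σ_{s∈T} f_s − Σ_{u∈𝓗∖T} g_u − (m−1)·(e₀ − e₁) ∈ L`. [folklore] -/
theorem rel_transversal_mem (hm : 2 ≤ m) (T : Finset G) (hTH : T ⊆ T₀.1 \ T₁.1) (hTm : T.card = m)
    (hT : ∀ t ∈ T₀.1 \ T₁.1, ∀ t' ∈ T₀.1, (t' = t * Q ∨ t' = c * (t * Q)) → (t ∈ T ↔ t' ∉ T)) :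
    ∑ s ∈ T, Finsupp.single (oflipCM c hc2 s T₀) (1 : ℤ) - ∑ u ∈ (T₀.1 \ T₁.1) \ T, Finsupp.single (oflipCM c hc2 u T₁) (1 : ℤ) -
      ((m : ℤ) - 1) • (Finsupp.single T₀ (1 : ℤ) - Finsupp.single T₁ 1) ∈ L := by
  obtain ⟨Φ, hΦ⟩ := exists_type_of_dev c hc2 T₀ T (hTH.trans sdiff_subset)
  -- the two star normal forms of `Φ`
  have h0 := single_sub_thetaG_mem_transversal c hc2 hcen T₀ T₁ hbase m hn hH Q hQ hQQ L hLrt hcover hm hσH T hTH hTm hT Φ (by rw [hΦ])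
  have hdev₁ : T₁.1 \ Φ.1 = ((T₀.1 \ T₁.1) \ T).image (fun x => c * x) := by
    rw [sdiff_eq_of_dev c hc2 T₀ T₁ Φ, hΦ, Finset.sdiff_eq_empty_iff_subset.mpr hTH, empty_union]
  have h1 := single_sub_thetaG_mem_transversal_exchange c hc2 hcen T₀ T₁ hbase m hn hH Q hQ hQQ hσH L hLrt hcover hm T hTH hTm hT Φ
    (by rw [hdev₁])
  -- their difference
  have hdiff := Submodule.sub_mem _ h1 h0
  rw [sub_sub_sub_cancel_left, thetaG_typeSum_single c T₀ hc2 Φ, thetaG_frame c hc2 T₀ T₁ Φ, hΦ,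
    Finset.sdiff_eq_empty_iff_subset.mpr hTH, sum_empty, zero_add] at hdiff
  have hcardD : (((T₀.1 \ T₁.1) \ T).card : ℤ) = m := by
    have h : ((T₀.1 \ T₁.1) \ T).card = m := by rw [card_sdiff_of_subset hTH, hH, hTm]; omega
    exact_mod_cast h
  have hTm' : (T.card : ℤ) = m := by exact_mod_cast hTm
  have e : ∑ s ∈ T, Finsupp.single (oflipCM c hc2 s T₀) (1 : ℤ) - ∑ u ∈ (T₀.1 \ T₁.1) \ T, Finsupp.single (oflipCM c hc2 u T₁) (1 : ℤ) -
      ((m : ℤ) - 1) • (Finsupp.single T₀ (1 : ℤ) - Finsupp.single T₁ 1) =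
      ((∑ t ∈ T, (Finsupp.single (oflipCM c hc2 t T₀) (1 : ℤ) - Finsupp.single T₀ 1)) + Finsupp.single T₀ 1) -
      ((∑ u ∈ (T₀.1 \ T₁.1) \ T, (Finsupp.single (oflipCM c hc2 u T₁) (1 : ℤ) - Finsupp.single T₁ 1)) + Finsupp.single T₁ 1) := by
    rw [sum_sub_distrib, sum_sub_distrib, sum_const, sum_const, ← Nat.cast_smul_eq_nsmul ℤ, ← Nat.cast_smul_eq_nsmul ℤ, hcardD, hTm']
    module
  rw [e]
  exact hdiff

/-! ## §4 The pair relation -/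

include hcen hbase hn hH hQ hQQ hσH hLrt hcover in
/-- **THE PAIR RELATION `R(T) + Y'_a + Y'_{a'} ∈ L`** (`m ≥ 3`): for a transversal `T ⊆ 𝓗` with `|T| = m`, `a ∈ T₀ ∩ T₁` and its swap image `a' ≠ a`:
`R(T) + ((f_a − e₀) − (g_a − e₁)) + ((f_{a'} − e₀) − (g_{a'} − e₁)) ∈ L`. [folklore] -/
theorem rel_transversal_pair_mem (hm : 3 ≤ m) (T : Finset G) (hTH : T ⊆ T₀.1 \ T₁.1) (hTm : T.card = m)
    (hT : ∀ t ∈ T₀.1 \ T₁.1, ∀ t' ∈ T₀.1, (t' = t * Q ∨ t' = c * (t * Q)) → (t ∈ T ↔ t' ∉ T))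
    {a a' : G} (ha : a ∈ T₀.1) (ha1 : a ∈ T₁.1) (ha' : a' ∈ T₀.1) (haa' : a' = a * Q ∨ a' = c * (a * Q)) (hne : a ≠ a') :
    (∑ s ∈ T, Finsupp.single (oflipCM c hc2 s T₀) (1 : ℤ) - ∑ u ∈ (T₀.1 \ T₁.1) \ T, Finsupp.single (oflipCM c hc2 u T₁) (1 : ℤ) -
      ((m : ℤ) - 1) • (Finsupp.single T₀ (1 : ℤ) - Finsupp.single T₁ 1)) +
      ((Finsupp.single (oflipCM c hc2 a T₀) (1 : ℤ) - Finsupp.single T₀ 1) - (Finsupp.single (oflipCM c hc2 a T₁) (1 : ℤ) - Finsupp.single T₁ 1)) +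
      ((Finsupp.single (oflipCM c hc2 a' T₀) (1 : ℤ) - Finsupp.single T₀ 1) - (Finsupp.single (oflipCM c hc2 a' T₁) (1 : ℤ) - Finsupp.single T₁ 1))
      ∈ L := by
  have ha'1 : a' ∈ T₁.1 := by
    have h := (hσH a ha a' ha' haa')
    by_contra h'
    exact (mem_sdiff.mp (h.mpr (mem_sdiff.mpr ⟨ha', h'⟩))).2 ha1
  have haH : a ∉ T₀.1 \ T₁.1 := fun h => (mem_sdiff.mp h).2 ha1
  have ha'H : a' ∉ T₀.1 \ T₁.1 := fun h => (mem_sdiff.mp h).2 ha'1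
  have hTA : Disjoint T ({a, a'} : Finset G) := by
    rw [disjoint_iff_ne]; rintro x hx y hy rfl
    rw [mem_insert, mem_singleton] at hy
    rcases hy with rfl | rfl
    · exact haH (hTH hx)
    · exact ha'H (hTH hx)
  have hAsub : ({a, a'} : Finset G) ⊆ T₀.1 := by
    intro x hx; rw [mem_insert, mem_singleton] at hx; rcases hx with rfl | rfl <;> assumption
  obtain ⟨Φ, hΦ⟩ := exists_type_of_dev c hc2 T₀ (T ∪ {a, a'}) (union_subset (hTH.trans sdiff_subset) hAsub)
  -- the two star normal forms of `Φ`
  have h0 := single_sub_thetaG_mem_transversal_pair c hc2 hcen T₀ T₁ hbase m hn hH Q hQ hQQ L hLrt hcover hm hσH T hTH hTm hT ha haH ha' haa'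
    hne Φ ⟨by rw [hΦ], Or.inl hΦ⟩
  have hD1 : (T₀.1 \ Φ.1) \ (T₀.1 \ T₁.1) = {a, a'} := by
    rw [hΦ, union_sdiff_distrib, Finset.sdiff_eq_empty_iff_subset.mpr hTH, empty_union]
    ext x; simp only [mem_sdiff, mem_insert, mem_singleton]
    constructor
    · exact fun h => h.1
    · rintro (rfl | rfl)
      · exact ⟨Or.inl rfl, fun h => haH (mem_sdiff.mpr h)⟩
      · exact ⟨Or.inr rfl, fun h => ha'H (mem_sdiff.mpr h)⟩
  have hD2 : (T₀.1 \ T₁.1) \ (T₀.1 \ Φ.1) = (T₀.1 \ T₁.1) \ T := by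
    rw [hΦ]
    ext x; simp only [mem_sdiff, mem_union, mem_insert, mem_singleton, not_or]
    constructor
    · rintro ⟨h, h1, -⟩; exact ⟨h, h1⟩
    · rintro ⟨h, h1⟩
      refine ⟨h, h1, ?_, ?_⟩
      · rintro rfl; exact haH (mem_sdiff.mpr h)
      · rintro rfl; exact ha'H (mem_sdiff.mpr h)
  have hdev₁ : T₁.1 \ Φ.1 = ((T₀.1 \ T₁.1) \ T).image (fun x => c * x) ∪ {a, a'} := by
    rw [sdiff_eq_of_dev c hc2 T₀ T₁ Φ, hD1, hD2, union_comm]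
  have h1 := single_sub_thetaG_mem_transversal_pair_exchange c hc2 hcen T₀ T₁ hbase m hn hH Q hQ hQQ hσH L hLrt hcover hm T hTH hTm hT
    ha ha1 ha' haa' hne Φ ⟨by rw [hdev₁], Or.inl hdev₁⟩
  have hdiff := Submodule.sub_mem _ h1 h0
  rw [sub_sub_sub_cancel_left, thetaG_typeSum_single c T₀ hc2 Φ, thetaG_frame c hc2 T₀ T₁ Φ, hD1, hD2, hΦ,
    sum_union hTA, sum_pair hne, sum_pair hne] at hdiff
  have hcardD : (((T₀.1 \ T₁.1) \ T).card : ℤ) = m := by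
    have h : ((T₀.1 \ T₁.1) \ T).card = m := by rw [card_sdiff_of_subset hTH, hH, hTm]; omega
    exact_mod_cast h
  have hTm' : (T.card : ℤ) = m := by exact_mod_cast hTm
  -- rewrite the target as the computed difference
  have e : (∑ s ∈ T, Finsupp.single (oflipCM c hc2 s T₀) (1 : ℤ) - ∑ u ∈ (T₀.1 \ T₁.1) \ T, Finsupp.single (oflipCM c hc2 u T₁) (1 : ℤ) -
      ((m : ℤ) - 1) • (Finsupp.single T₀ (1 : ℤ) - Finsupp.single T₁ 1)) +
      ((Finsupp.single (oflipCM c hc2 a T₀) (1 : ℤ) - Finsupp.single T₀ 1) - (Finsupp.single (oflipCM c hc2 a T₁) (1 : ℤ) - Finsupp.single T₁ 1)) +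
      ((Finsupp.single (oflipCM c hc2 a' T₀) (1 : ℤ) - Finsupp.single T₀ 1) - (Finsupp.single (oflipCM c hc2 a' T₁) (1 : ℤ) - Finsupp.single T₁ 1)) =
      ((∑ t ∈ T, (Finsupp.single (oflipCM c hc2 t T₀) (1 : ℤ) - Finsupp.single T₀ 1)) +
        ((Finsupp.single (oflipCM c hc2 a T₀) (1 : ℤ) - Finsupp.single T₀ 1) + (Finsupp.single (oflipCM c hc2 a' T₀) (1 : ℤ) - Finsupp.single T₀ 1)) +
        Finsupp.single T₀ 1) -
      (((Finsupp.single (oflipCM c hc2 a T₁) (1 : ℤ) - Finsupp.single T₁ 1) + (Finsupp.single (oflipCM c hc2 a' T₁) (1 : ℤ) - Finsupp.single T₁ 1)) +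
        (∑ u ∈ (T₀.1 \ T₁.1) \ T, (Finsupp.single (oflipCM c hc2 u T₁) (1 : ℤ) - Finsupp.single T₁ 1)) + Finsupp.single T₁ 1) := by
    rw [sum_sub_distrib, sum_sub_distrib, sum_const, sum_const, ← Nat.cast_smul_eq_nsmul ℤ, ← Nat.cast_smul_eq_nsmul ℤ, hcardD, hTm']
    module
  rw [e]
  exact hdiff

end Frame

end

end Summit.HodgeConjecture.CorCM.Census.CentralSquares
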